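import Literature.AlgebraicGeometry.Motives.GrassmannianUniversalSubbundleSections
import Literature.AlgebraicGeometry.Motives.GrassmannianUniversalSubbundle
import Literature.AlgebraicGeometry.Modules.QuasicoherentAbelian
import Literature.AlgebraicGeometry.Morphisms.CohOfVectorBundle
import Literature.AlgebraicGeometry.KTheory.GrothendieckGroup
import HarnessLib

/-!
# Multiplication maps on the Grassmannian: `μ_m : ∏_{J₁} 𝒦 ⟶ 𝒪_{Gr}^{(J₂)}` for a bilinear `m : M₁ × M → M₂`

Topic `AlgebraicGeometry/Motives`; namespaces `Literature.AlgebraicGeometry.Modules` (§1, generic) and `….Motives.Grassmannian` (§2).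
OBJECTS file (two `def`s + their section formulas and affine-local properties; no instance, no notation, no named fact, no `sorry`).
Cell `hodgecm-mathlib` (D-0151), (q2) of the (h4) Grassmannian line (B-plan1 (g16) 07:26:26Z; census
`B-provers/B-p18/g18/CENSUS-q2-GrassmannianSubbundleBilinearMap.B-p18g18.md`): the GENERIC half of the determinantal description of
«`Hilb ↪ Grass`» (F-5 (5d)) — no Hilbert object is typed here.

* §1 for a scheme `T`, free `ℤ`-modules `M`, `M₂` with bases `b : J → M`, `b₂ : J₂ → M₂` (`J₂` finite) and a `ℤ`-linear `ℓ : M → M₂`: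
  **`freeModuleHomOfLinearMap T b b₂ ℓ : 𝒪_T^{(J)} ⟶ 𝒪_T^{(J₂)}`**, `ε_j ↦ Σ_{j₂} b₂.coord_{j₂}(ℓ (b j)) · ε_{j₂}`
  (`freeModuleHomOfLinearMap_app_freeSectionOn`), and **`freeModuleHomOfLinearMap_app_sectionsMap`** — on sections over any open `V`
  it is `1 ⊗ ℓ : Γ(T, V) ⊗ M → Γ(T, V) ⊗ M₂` read through the sections maps `θ_V(𝒪^{(J)}, ε)`, `θ_V(𝒪^{(J₂)}, ε)` of ★ `GrassmannianClassifyQuotient`;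
* §2 on `Gr = grassmannianScheme M k` with `π : 𝒪^{(J)} ↠ 𝒬` (★ `universalQuotientπ`) and the universal subbundle `𝒦 := kernel π`
  (★ `GrassmannianUniversalSubbundle`): for a finite family `m : J₁ → (M →ₗ[ℤ] M₂)` (a bilinear map `M₁ ⊗ M → M₂` read on a basis of `M₁`)
  **`subbundleFamilyMap k M b b₂ m : ∏ᶜ (fun _ : J₁ => 𝒦) ⟶ 𝒪_{Gr}^{(J₂)}`**, `μ_m := Σ_{j₁} pr_{j₁} ≫ (𝒦 ↪ 𝒪^{(J)}) ≫ ν_{m j₁}`, with the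
  coordinate formula `subbundleFamilyMap_app` (`(μ_m)_V x = Σ_{j₁} (ν_{m j₁})_V (ι_V (pr_{j₁} x))`), the per-summand reading through the universal
  submodule `N_V = x₀|_V ⊆ Γ(V) ⊗ M` on affine `V` (★ `exists_linearEquiv_kernel_universalQuotientπ_sections`):
  `subbundleFamilyMap_app_eq_sum_sectionsMap`, and the affine-local properties the rank loci of ★ `MorphismRankLoci` consume:
  `isAffineLocalizing_piObj_kernel_universalQuotientπ`, `Modules.isAffineFiniteType_freeModule`, `Modules.isAffineLocalizing_freeModule` (★).
  The image of `(μ_m)_V` is `Σ_{j₁} (1 ⊗ m j₁)(N_V)` — the «`S₁ · K`» of the determinantal condition.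

[GortzWedhorn2020, (8.4) (pp. 213–215)]; [Hartshorne1977, II §5 (p. 109), II Prop. 5.7 (p. 114)]; [StacksProject, Tags 089R, 01LA].
Count-neutral Mathlib-side capital; nothing here is about HC — HC_CM is proved only modulo the 7 printed citations until rung 0 closes.
-/

noncomputable section
-- `TopCat.Presheaf`/`Scheme.Modules` are not reducible (as in Mathlib's `AlgebraicGeometry/Modules/Tilde.lean`).
set_option backward.isDefEq.respectTransparency false

open CategoryTheory Opposite TensorProduct TopologicalSpace AlgebraicGeometry Limits
open Literature.AlgebraicGeometry.Motives Literature.AlgebraicGeometry.Morphisms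

universe u

/-! ## §1 The free-module morphism of a `ℤ`-linear map -/

namespace Literature.AlgebraicGeometry.Modules

open Literature.AlgebraicGeometry.Motives.Grassmannian

variable (T : Scheme.{u}) {J J₂ : Type u} [Fintype J₂] {M M₂ : Type u} [AddCommGroup M] [AddCommGroup M₂]
  (b : Module.Basis J ℤ M) (b₂ : Module.Basis J₂ ℤ M₂) (ℓ : M →ₗ[ℤ] M₂)

/-- **The morphism `ν_ℓ : 𝒪_T^{(J)} ⟶ 𝒪_T^{(J₂)}` of a `ℤ`-linear map `ℓ : M → M₂`** in the bases `b`, `b₂`: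
`ε_j ↦ Σ_{j₂} b₂.coord_{j₂}(ℓ (b j)) · ε_{j₂}` (Mathlib `SheafOfModules.freeHomEquiv` on the compatible families of these global sections).
[cite: Hartshorne1977, II §5 (p. 109)] -/
def freeModuleHomOfLinearMap : freeModule T J ⟶ freeModule T J₂ :=
  (freeModule T J₂).freeHomEquiv.symm fun j =>
    PresheafOfModules.sectionsMk (M := (freeModule T J₂).val)
      (fun V => (freeModule T J₂).presheaf.map (homOfLE (le_top : V.unop ≤ ⊤)).op
        (∑ j₂, (b₂.coord j₂ (ℓ (b j)) : ℤ) • freeSectionOn T j₂ ⊤))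
      fun V V' i => by
        change ((freeModule T J₂).presheaf.map _ ≫ (freeModule T J₂).presheaf.map i) _ = _
        rw [← Functor.map_comp]
        rfl

/-- `ν_ℓ (ε_j|_V) = Σ_{j₂} b₂.coord_{j₂}(ℓ (b j)) · ε_{j₂}|_V`. [cite: Hartshorne1977, II §5 (p. 109)] -/
theorem freeModuleHomOfLinearMap_app_freeSectionOn (j : J) (V : T.Opens) :
    (freeModuleHomOfLinearMap T b b₂ ℓ).app V (freeSectionOn T j V) =
      ∑ j₂, (b₂.coord j₂ (ℓ (b j)) : ℤ) • freeSectionOn T j₂ V := by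
  have h := congrArg (fun t : (freeModule T J₂).sections => t.eval (op V))
    (SheafOfModules.sectionsMap_freeHomEquiv_symm_freeSection (M := freeModule T J₂)
      (fun j => PresheafOfModules.sectionsMk (M := (freeModule T J₂).val)
        (fun V => (freeModule T J₂).presheaf.map (homOfLE (le_top : V.unop ≤ ⊤)).op
          (∑ j₂, (b₂.coord j₂ (ℓ (b j)) : ℤ) • freeSectionOn T j₂ ⊤))
        fun V V' i => by
          change ((freeModule T J₂).presheaf.map _ ≫ (freeModule T J₂).presheaf.map i) _ = _
          rw [← Functor.map_comp]
          rfl) j)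
  change (freeModuleHomOfLinearMap T b b₂ ℓ).app V (freeSectionOn T j V) =
    (freeModule T J₂).presheaf.map (homOfLE (le_top : V ≤ ⊤)).op (∑ j₂, (b₂.coord j₂ (ℓ (b j)) : ℤ) • freeSectionOn T j₂ ⊤) at h
  rw [h, map_sum]
  refine Finset.sum_congr rfl fun j₂ _ => ?_
  rw [map_zsmul, map_freeSectionOn]

/-- The sections map of the free module on `1 ⊗ m` expands in the basis: `θ_V(1 ⊗ m) = Σ_j b.coord_j(m) · ε_j|_V` (`J` finite).
[cite: GortzWedhorn2020, (8.4) (pp. 213–215)] -/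
theorem sectionsMap_freeModule_one_tmul [Fintype J] (V : T.Opens) (x : M) :
    sectionsMap b (freeModule T J) (fun j => freeSectionOn T j ⊤) V ((1 : Γ(T, V)) ⊗ₜ[ℤ] x) =
      ∑ j, (b.coord j x : ℤ) • freeSectionOn T j V := by
  conv_lhs => rw [← b.sum_repr x, TensorProduct.tmul_sum, map_sum]
  refine Finset.sum_congr rfl fun j _ => ?_
  rw [TensorProduct.tmul_smul, map_zsmul, sectionsMap_one_tmul, map_freeSectionOn, Module.Basis.coord_apply]

/-- **On sections, `ν_ℓ` IS `1 ⊗ ℓ`** through the sections maps of the free modules: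
`(ν_ℓ)_V (θ_V(𝒪^{(J)}, ε) z) = θ_V(𝒪^{(J₂)}, ε) ((1 ⊗ ℓ) z)` for every `z ∈ Γ(T, V) ⊗ M`.
[cite: GortzWedhorn2020, (8.4) (pp. 213–215)] [cite: Hartshorne1977, II §5 (p. 109)] -/
theorem freeModuleHomOfLinearMap_app_sectionsMap (V : T.Opens) (z : Γ(T, V) ⊗[ℤ] M) :
    (freeModuleHomOfLinearMap T b b₂ ℓ).app V (sectionsMap b (freeModule T J) (fun j => freeSectionOn T j ⊤) V z) =
      sectionsMap b₂ (freeModule T J₂) (fun j₂ => freeSectionOn T j₂ ⊤) V (ℓ.baseChange Γ(T, V) z) := by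
  induction z using TensorProduct.induction_on with
  | zero => rw [map_zero, map_zero, map_zero, map_zero]
  | tmul a x =>
    rw [sectionsMap_tmul b (freeModule T J) _ V a x, Scheme.Modules.Hom.app_smul, LinearMap.baseChange_tmul,
      sectionsMap_tmul b₂ (freeModule T J₂) _ V a (ℓ x)]
    congr 1
    -- both sides are `ℤ`-linear in `x`; compare them on the basis `b`
    let f₁ : M →ₗ[ℤ] Γ(freeModule T J₂, V) := (appLinear (freeModuleHomOfLinearMap T b b₂ ℓ) V).restrictScalars ℤ ∘ₗ
      ((sectionsMap b (freeModule T J) (fun j => freeSectionOn T j ⊤) V).restrictScalars ℤ ∘ₗ TensorProduct.mk ℤ Γ(T, V) M 1)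
    let f₂ : M →ₗ[ℤ] Γ(freeModule T J₂, V) :=
      ((sectionsMap b₂ (freeModule T J₂) (fun j₂ => freeSectionOn T j₂ ⊤) V).restrictScalars ℤ ∘ₗ TensorProduct.mk ℤ Γ(T, V) M₂ 1) ∘ₗ ℓ
    have hf : f₁ = f₂ := by
      refine b.ext fun j => ?_
      change (freeModuleHomOfLinearMap T b b₂ ℓ).app V
          (sectionsMap b (freeModule T J) (fun j => freeSectionOn T j ⊤) V ((1 : Γ(T, V)) ⊗ₜ[ℤ] b j)) =
        sectionsMap b₂ (freeModule T J₂) (fun j₂ => freeSectionOn T j₂ ⊤) V ((1 : Γ(T, V)) ⊗ₜ[ℤ] ℓ (b j))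
      rw [sectionsMap_one_tmul, map_freeSectionOn, freeModuleHomOfLinearMap_app_freeSectionOn, sectionsMap_freeModule_one_tmul]
    exact LinearMap.congr_fun hf x
  | add z z' hz hz' => rw [map_add, map_add, hz, hz', map_add, map_add]

/-- The free module `𝒪_T^{(J)}` on a finite `J` is of affine-finite type (finite locally free). [cite: Hartshorne1977, II Prop. 5.7 (p. 114)] -/
theorem isAffineFiniteType_freeModule (J : Type u) [Finite J] : IsAffineFiniteType (freeModule T J) :=
  (coh_of_isVectorBundle (KTheory.KZero.isFiniteLocallyFree_free (X := T) J).isVectorBundle).ft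

end Literature.AlgebraicGeometry.Modules

/-! ## §2 The multiplication maps `μ_m : ∏_{J₁} 𝒦 ⟶ 𝒪_{Gr}^{(J₂)}` -/

namespace Literature.AlgebraicGeometry.Motives.Grassmannian

open Literature.AlgebraicGeometry.Modules

variable (k : ℕ) (M : Type u) [AddCommGroup M] {J : Type u} (b : Module.Basis J ℤ M)
  [(grassmannianSheaf M k).obj.IsRepresentable] {M₂ : Type u} [AddCommGroup M₂] {J₂ : Type u} [Fintype J₂]
  (b₂ : Module.Basis J₂ ℤ M₂) {J₁ : Type u} [Fintype J₁] (m : J₁ → (M →ₗ[ℤ] M₂))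

/-- A Fitting morphism sum: sections of a finite sum of morphisms. [cite: Hartshorne1977, II §5 (p. 109)] -/
theorem app_finset_sum {X : Scheme.{u}} {P Q : X.Modules} {ι : Type*} (s : Finset ι) (φ : ι → (P ⟶ Q)) (V : X.Opens) (x : Γ(P, V)) :
    (∑ i ∈ s, φ i).app V x = ∑ i ∈ s, (φ i).app V x := by
  classical
  induction s using Finset.induction_on with
  | empty => rw [Finset.sum_empty, Finset.sum_empty, Scheme.Modules.Hom.zero_app]; rfl
  | insert a s ha ih => rw [Finset.sum_insert ha, Finset.sum_insert ha, Scheme.Modules.Hom.add_app, ← ih]; rfl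

/-- **THE MULTIPLICATION MAP `μ_m : ∏_{j₁ ∈ J₁} 𝒦 ⟶ 𝒪_{Gr}^{(J₂)}`** of a family `m : J₁ → (M →ₗ[ℤ] M₂)` of `ℤ`-linear maps (a bilinear
`M₁ ⊗ M → M₂` on a basis of `M₁`): `Σ_{j₁} pr_{j₁} ≫ (𝒦 ↪ 𝒪_{Gr}^{(J)}) ≫ ν_{m j₁}`, where `𝒦 = ker (π : 𝒪^{(J)} ↠ 𝒬)` is the universal
subbundle. [cite: GortzWedhorn2020, (8.4) (pp. 213–215)] [cite: StacksProject, Tag 089R] -/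
def subbundleFamilyMap : (∏ᶜ fun _ : J₁ => kernel (universalQuotientπ k M b)) ⟶ freeModule (grassmannianScheme M k) J₂ :=
  ∑ j₁, Pi.π (fun _ : J₁ => kernel (universalQuotientπ k M b)) j₁ ≫ kernel.ι (universalQuotientπ k M b) ≫
    freeModuleHomOfLinearMap (grassmannianScheme M k) b b₂ (m j₁)

/-- **Coordinate formula**: `(μ_m)_V x = Σ_{j₁} (ν_{m j₁})_V (ι_V ((pr_{j₁})_V x))`. [cite: GortzWedhorn2020, (8.4) (pp. 213–215)] -/
theorem subbundleFamilyMap_app (V : (grassmannianScheme M k).Opens) (x : Γ(∏ᶜ fun _ : J₁ => kernel (universalQuotientπ k M b), V)) :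
    (subbundleFamilyMap k M b b₂ m).app V x =
      ∑ j₁, (freeModuleHomOfLinearMap (grassmannianScheme M k) b b₂ (m j₁)).app V
        ((kernel.ι (universalQuotientπ k M b)).app V ((Pi.π (fun _ : J₁ => kernel (universalQuotientπ k M b)) j₁).app V x)) := by
  rw [subbundleFamilyMap, app_finset_sum]
  rfl

/-- **Reading through the universal submodule**: on an affine open `V ⊆ Gr`, with `e : Γ(𝒦, V) ≃ N_V = x₀|_V` any identification
compatible with `𝒦 ↪ 𝒪^{(J)}` (★ `exists_linearEquiv_kernel_universalQuotientπ_sections`), the `j₁`-th summand of `(μ_m)_V x` is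
`θ_V(𝒪^{(J₂)}, ε) ((1 ⊗ m j₁) (e (pr_{j₁} x)))` — the multiplication `m j₁` applied to the universal submodule.
[cite: GortzWedhorn2020, (8.4) (pp. 213–215)] [cite: StacksProject, Tag 089R] -/
theorem subbundleFamilyMap_app_eq_sum_sectionsMap {V : (grassmannianScheme M k).Opens} (hV : IsAffineOpen V)
    (e : Γ(kernel (universalQuotientπ k M b), V) ≃ₗ[Γ(grassmannianScheme M k, V)]
      (evalAffine hV (pointsEquiv M k _ (𝟙 (grassmannianScheme M k)))).toSubmodule)
    (he : ∀ s, sectionsMap b (freeModule (grassmannianScheme M k) J) (fun j => freeSectionOn (grassmannianScheme M k) j ⊤) V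
      (e s : Γ(grassmannianScheme M k, V) ⊗[ℤ] M) = (kernel.ι (universalQuotientπ k M b)).app V s)
    (x : Γ(∏ᶜ fun _ : J₁ => kernel (universalQuotientπ k M b), V)) :
    (subbundleFamilyMap k M b b₂ m).app V x =
      ∑ j₁, sectionsMap b₂ (freeModule (grassmannianScheme M k) J₂) (fun j₂ => freeSectionOn (grassmannianScheme M k) j₂ ⊤) V
        ((m j₁).baseChange Γ(grassmannianScheme M k, V)
          (e ((Pi.π (fun _ : J₁ => kernel (universalQuotientπ k M b)) j₁).app V x) : Γ(grassmannianScheme M k, V) ⊗[ℤ] M)) := by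
  rw [subbundleFamilyMap_app]
  refine Finset.sum_congr rfl fun j₁ _ => ?_
  rw [← he, freeModuleHomOfLinearMap_app_sectionsMap]

omit [Fintype J₂] in
/-- The source `∏_{J₁} 𝒦` is affine-localizing (quasi-coherent): finite products of affine-localizing modules (★ `QuasicoherentAbelian`).
[cite: StacksProject, Tag 01LA] [cite: Hartshorne1977, II Prop. 5.7 (p. 114)] -/
theorem isAffineLocalizing_piObj_kernel_universalQuotientπ [Fintype J] :
    IsAffineLocalizing (∏ᶜ fun _ : J₁ => kernel (universalQuotientπ k M b)) :=
  (isAffineLocalizing (grassmannianScheme M k)).prop_product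
    (f := fun _ : J₁ => kernel (universalQuotientπ k M b)) fun _ => isAffineLocalizing_kernel_universalQuotientπ k M b

end Literature.AlgebraicGeometry.Motives.Grassmannian

end
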